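import Literature.MathematicalPhysics.QuantumFieldTheory.Balaban1983to89.B6Partition118KLevelFineLip
import Literature.MathematicalPhysics.QuantumFieldTheory.Balaban1983to89.B6Ineq2134ThetaKLevel

/-!
# `Balaban1983to89.B6Partition118KLevelFineKIdx` — T. Bałaban, *Propagators and renormalization transformations for lattice gauge theories. II*,
# Commun. Math. Phys. **96** (1984) 223–250 [Balaban1984PropagatorsII], (2.36) p. 229 / (2.89)–(2.92) p. 239 / (2.134) p. 247: THE SMOOTH PARTITION `{h_□}`
# AND THE CUT-OFFS `{ζ_□}` ON THE VECTOR-FIELD LATTICE OF THE GENUINE k-LEVEL FAMILY `i : KIdx d ℓ` — the `h`/`ζ`/`S`/`Score` data of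
# `…B6Ineq2134KFamKLevel.h2134_kFam_kLevel` and the partition identity `Σ_□ h_□·h_□ = 1` of `…B6Eq291Generator.eq291`, in the census geometry `geoB i`
# (file 5 of the family: the one-line lift `(μ, x) ↦ h_□(x)` of files 1–4)

statement-level skeleton of published theorems with citation tags; proofs where landed; nothing here is a claim about the Yang–Mills mass gap

PDF held: `paper:balaban1984-cmp96-propagators-rt-ii` (journal page = PDF page + 222): p. 229 [PDF 7], p. 239 [PDF 17], p. 247 [PDF 25]; read from the tree
transcriptions (`…B6Cover236MultiLevelBlocks`, `…B6Eq291Generator`, `…B6Ineq2134Diag`).  PRINT p. 239: *"G₀ = Σ_□ h_□G_□h_□ (2.89) … R = Σ_{□,□′}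
K_{□,□′}G_□′h_□′ (2.91)"* (the kernels act on vector fields `A_μ(x)`; `h_□`, `ζ_□` multiply every component by the same scalar function of `x`).

CITATION HEADER (lean-in-tree rule) — WHAT IS REPRODUCED.  Phase-2 file of the `lit-balaban` typed skeleton (HOME `run/shared/lean/pub/lit-balaban/`), seat
**p38 gen 25**; offer (1) of B6-CLOSURE §5 item 7 (owner r03 g18, 2026-08-22T22:35:35Z: *"Carrier: the fine box of `KIdx` (`XV i` for vector fields /
`↥i.XB` for the scalar h)"*), FILE 5; SKELETON rows **B6.Eq2.36** × **B6.Eq2.91** × **B6.Eq2.134** × **B6.Prop2.6** (cells only; decls of record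
untouched; referee ref-4).  Files 1–4 built `hF D □`, `zetaB D □` and their constants for every `D : Domains d ℓ M_h k P R`.  THIS FILE specialises to
`D := i.D` of a census member `i : KIdx d ℓ` (`…B6Prop22KLevelCensus`) and lifts to gen 24's vector-field lattice `XV i = Fin (d+1) × ↥i.XB` with block
map `blkV i (μ, x) = blkOf i.D x` and census geometry `geoB i` (`M = L·M_h`, `dist` = (2.46) of `geom i.D`, by `rfl`):
* §1 `hV i □ (μ, x) = hF i.D □ x`, `zetaV i □ (μ, x) = zetaB i.D □ x`; **`sum_mulOp_hV`**: `Σ_□ mulOp (hV i □) * mulOp (hV i □) = 1` in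
  `End(XV i → ℝ)` (the hypothesis `hpart` of `…B6Eq291Generator.eq291` / `hG0` side of `…B6Prop26Gluing`), and `Σ_□ hV i □ q² = 1` pointwise;
* §2 **`partition118_kLevel`**: for `L ≥ 2` and `M_h ≥ 2` (implied by the consumers' `M₀ ≤ L·M_h` once `M₀ ≥ 2L`, `two_le_Mh_of_le`) the binders of
  `h2134_kFam_kLevel` on `geoB i` with `C := ↥(cubes i.D)`, `Dc := univ`, `S □ := ↑(Q i.D □)`, `Score □ := ↑(Qbig i.D □)`, `s := sLipF d ℓ`, `r₀ := 1`,
  `m := 1/(4L)`: `hh1`, `hhS`, `hLip`, `hζ0`, `hζ1`, `hζS`, `hgap` verbatim, + `|hV| sum of squares = 1` and the fine-step sizes `C1F/(8S/5)`, `C2F/(8S/5)²`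
  (the material of the line-1 binders `hcf`, `hc₀`, whose operators `E`, `cf`, `c₀` belong to the vector model of item 7 (d1)).
* §3 the fine-step sizes in LEVEL FORM: `lev_le_of_near_supp` (`j(y(x)) ≤ j(□) + 1` within `1` of `supp h_□`), `C1F_div_sF_le_level`
  (`C1F/(8S/5) ≤ ((5/8)C1F·L)/(M·L^{j(y)})`), `C2F_div_sF_sq_le_level` (`C2F/(8S/5)² ≤ ((25/64)C2F·L)/(M·L^{2j(y)})`) — the shapes `s₁/(M·L^jη)`,
  `s₂/(M(L^jη)²)` of `hcf`/`hc₀` up to the factors `η^{−1}`, `η^{−2}` of the lattice derivatives.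
No new fact; two defs with bodies (`hV`, `zetaV`); standard axioms.
HONEST SCOPE. As files 1–4; the sets `T_□ ⊇ S_□` (where the local propagators' majorants hold), the operators of lines 1–3 and the choice of the
local projections are the (d)-assembly's (B6-CLOSURE §5 item 7), not fixed here.  Integer box; nothing on d = 4 or the continuum; NOT summit progress.
Unit `lit-balaban-p38` (gen 25), 2026-08-22.
-/

namespace Literature.MathematicalPhysics.QuantumFieldTheory.Balaban1983to89.B6Partition118KLevelFineKIdx

open Finset
open Literature.MathematicalPhysics.QuantumFieldTheory.Balaban1983to89.B4Reflection242 (boxDom)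
open Literature.MathematicalPhysics.QuantumFieldTheory.Balaban1983to89.B6MultiLevelBoxOperator
open Literature.MathematicalPhysics.QuantumFieldTheory.Balaban1983to89.B6Geom246MultiLevelBox
open Literature.MathematicalPhysics.QuantumFieldTheory.Balaban1983to89.B6Cover236MultiLevelBlocks (cubes side Q)
open Literature.MathematicalPhysics.QuantumFieldTheory.Balaban1983to89.B6Prop22KLevelCensus (KIdx)
open Literature.MathematicalPhysics.QuantumFieldTheory.Balaban1983to89.B6Ineq288MultiLevelBox (geoB geoB_M geoB_dist)
open Literature.MathematicalPhysics.QuantumFieldTheory.Balaban1983to89.B6Ineq2134ThetaKLevel (XV blkV)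
open Literature.MathematicalPhysics.QuantumFieldTheory.Balaban1983to89.B6Prop26Gluing (mulOp mulOp_apply)
open Literature.MathematicalPhysics.QuantumFieldTheory.Balaban1983to89.B6Partition118KLevelFine (sF hF sum_hF_sq sum_hF_mul_self abs_hF_le_one)
open Literature.MathematicalPhysics.QuantumFieldTheory.Balaban1983to89.B6Partition118KLevelFineSizes (C1F)
open Literature.MathematicalPhysics.QuantumFieldTheory.Balaban1983to89.B6Partition118KLevelFineSecond (C2F)
open Literature.MathematicalPhysics.QuantumFieldTheory.Balaban1983to89.B6Partition118KLevelFineLip (sLipF Qbig zetaB partition118_fine)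

variable {d ℓ : ℕ}

/-! ## §1  `h_□`, `ζ_□` on vector fields and the partition identity -/

/-- **`h_□` ON VECTOR FIELDS**: `(μ, x) ↦ h_□(x)`. [cite: Balaban1984PropagatorsII, (2.89)–(2.91) p.239] -/
noncomputable def hV (i : KIdx d ℓ) (c : ↥(cubes i.D)) : XV i → ℝ := fun q => hF i.D c q.2

/-- **`ζ_□` ON VECTOR FIELDS**: `(μ, x) ↦ ζ_□(x)`. [cite: Balaban1984PropagatorsII, (2.91)–(2.92) p.239] -/
noncomputable def zetaV (i : KIdx d ℓ) (c : ↥(cubes i.D)) : XV i → ℝ := fun q => zetaB i.D c q.2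

/-- `hV` evaluated. [cite: Balaban1984PropagatorsII, (2.89) p.239, dictionary] -/
@[simp] theorem hV_apply (i : KIdx d ℓ) (c : ↥(cubes i.D)) (q : XV i) : hV i c q = hF i.D c q.2 := rfl

/-- `zetaV` evaluated. [cite: Balaban1984PropagatorsII, (2.91) p.239, dictionary] -/
@[simp] theorem zetaV_apply (i : KIdx d ℓ) (c : ↥(cubes i.D)) (q : XV i) : zetaV i c q = zetaB i.D c q.2 := rfl

/-- **(2.36) on vector fields**: `Σ_□ h_□(q)² = 1`. [cite: Balaban1984PropagatorsII, (2.36) p.229] -/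
theorem sum_hV_sq (i : KIdx d ℓ) (q : XV i) : ∑ c, hV i c q ^ 2 = 1 := sum_hF_sq i.D i.hMh q.2

/-- **THE PARTITION IDENTITY IN `End(XV i → ℝ)`**: `Σ_□ h_□·h_□ = 1` (the hypothesis `hpart` of `…B6Eq291Generator.eq291`).
[cite: Balaban1984PropagatorsII, (2.36) p.229, (2.91) p.239] -/
theorem sum_mulOp_hV (i : KIdx d ℓ) : ∑ c, mulOp (hV i c) * mulOp (hV i c) = 1 := by
  refine LinearMap.ext fun v => funext fun q => ?_
  rw [LinearMap.coe_sum, Finset.sum_apply, Finset.sum_apply]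
  simp only [Module.End.mul_apply, mulOp_apply, Module.End.one_apply]
  calc ∑ c, hV i c q * (hV i c q * v q) = (∑ c, hF i.D c q.2 * hF i.D c q.2) * v q := by
        rw [Finset.sum_mul]; refine Finset.sum_congr rfl fun c _ => ?_; simp only [hV_apply]; ring
    _ = v q := by rw [sum_hF_mul_self i.D i.hMh q.2, one_mul]

/-! ## §2  The binders of the (2.134) gluing on `geoB i` -/

/-- `M_h ≥ 2` from the consumers' largeness hypothesis `M₀ ≤ L·M_h` once `M₀ ≥ 2L`. [cite: Balaban1984PropagatorsII, Prop. 2.6 p.247 («for M large enough»), bookkeeping] -/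
theorem two_le_Mh_of_le (i : KIdx d ℓ) {M₀ : ℝ} (hM₀ : 2 * ((ℓ : ℝ) + 1) ≤ M₀) (hM : M₀ ≤ ((ℓ : ℝ) + 1) * i.Mh) : 2 ≤ i.Mh := by
  have hL : (0 : ℝ) < (ℓ : ℝ) + 1 := by positivity
  have h : (2 : ℝ) ≤ i.Mh := le_of_mul_le_mul_left (by linarith) hL
  exact_mod_cast h

/-- **THE `h`/`ζ` DATA OF THE (2.134) GLUING ON THE GENUINE k-LEVEL FAMILY**: for `L ≥ 2` and a member `i : KIdx d ℓ` with `M_h ≥ 2`, with cubes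
`C := ↥(cubes i.D)`, `S_□ := Q i.D □` (print's □⁺), `Score_□ := Qbig i.D □` (print's □̃), in the census geometry `geoB i` (`M = L·M_h`, distance (2.46)):
`Σ_□ h_□² = 1`; `|h_□| ≤ 1` (`hh1`); `h_□(q) ≠ 0 ⇒ y(q) ∈ S_□` (`hhS`); `|h_□(q′) − h_□(q)| ≤ (sLipF/M)(d(y(q), y(q′)) + 1)` (`hLip`, `r₀ = 1`);
`0 ≤ ζ_□ ≤ 1` (`hζ0`, `hζ1`); `ζ_□(q) ≠ 1 ⇒ y(q) ∉ Score_□` (`hζS`); `y ∉ Score_□, y″ ∈ S_□ ⇒ (1/(4L))·M ≤ d(y, y″)` (`hgap`); and the fine-step sizes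
`C1F/(8S/5)`, `C2F/(8S/5)²` of `h_□` along the lattice (for `hcf`/`hc₀`). [cite: Balaban1984PropagatorsII, (2.36) p.229, (2.89)–(2.92) p.239, (2.134) p.247] -/
theorem partition118_kLevel (hℓ : 1 ≤ ℓ) (i : KIdx d ℓ) (hMh : 2 ≤ i.Mh) :
    (∀ q : XV i, ∑ c, hV i c q ^ 2 = 1) ∧
    (∀ (c : ↥(cubes i.D)) (q : XV i), |hV i c q| ≤ 1) ∧
    (∀ (c : ↥(cubes i.D)) (q : XV i), hV i c q ≠ 0 → blkV i q ∈ ((Q i.D c : Finset ↥(bset i.D)) : Set ↥(bset i.D))) ∧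
    (∀ (c : ↥(cubes i.D)) (q q' : XV i),
      |hV i c q' - hV i c q| ≤ sLipF d ℓ / (geoB i).M * ((geoB i).dist (blkV i q) (blkV i q') + 1)) ∧
    (∀ (c : ↥(cubes i.D)) (q : XV i), 0 ≤ zetaV i c q) ∧
    (∀ (c : ↥(cubes i.D)) (q : XV i), zetaV i c q ≤ 1) ∧
    (∀ (c : ↥(cubes i.D)) (q : XV i), zetaV i c q ≠ 1 → blkV i q ∉ ((Qbig i.D c : Finset ↥(bset i.D)) : Set ↥(bset i.D))) ∧
    (∀ (c : ↥(cubes i.D)) (y y'' : ↥(bset i.D)), y ∉ ((Qbig i.D c : Finset ↥(bset i.D)) : Set ↥(bset i.D)) → y'' ∈ ((Q i.D c : Finset ↥(bset i.D)) : Set ↥(bset i.D)) →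
      1 / (4 * ((ℓ : ℝ) + 1)) * (geoB i).M ≤ (geoB i).dist y y'') ∧
    (∀ (c : ↥(cubes i.D)) (q q' : XV i), dist (toR q.2.1) (toR q'.2.1) ≤ 1 → |hV i c q' - hV i c q| ≤ C1F d ℓ / sF i.D c) ∧
    (∀ (c : ↥(cubes i.D)) (μ ν : Fin (d + 1)) (x xp xm : ↥(i.XB)), xp.1 = Function.update x.1 ν (x.1 ν + 1) →
      xm.1 = Function.update x.1 ν (x.1 ν + (-1)) → |hV i c (μ, xp) - 2 * hV i c (μ, x) + hV i c (μ, xm)| ≤ C2F d ℓ / sF i.D c ^ 2) := by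
  obtain ⟨h1, h2, h3, h4, h5, h6, h7, h8, h9, h10⟩ := partition118_fine i.D hℓ hMh i.hP i.hR
  refine ⟨fun q => sum_hV_sq i q, fun c q => h2 c q.2, fun c q h => ?_, fun c q q' => ?_, fun c q => h5 c q.2, fun c q => h6 c q.2,
    fun c q h => ?_, fun c y y'' hy hy'' => ?_, fun c q q' h => h9 c q.2 q'.2 h, fun c μ ν x xp xm hp hm => h10 c ν x xp xm hp hm⟩
  · exact Finset.mem_coe.2 (h3 c q.2 h)
  · rw [geoB_M, geoB_dist]; exact h4 c q.2 q'.2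
  · exact fun hm => h7 c q.2 h (Finset.mem_coe.1 hm)
  · rw [geoB_M, geoB_dist]; exact h8 c y y'' (fun hm => hy (Finset.mem_coe.2 hm)) (Finset.mem_coe.1 hy'')

/-! ## §3  The fine-step sizes in level form (the shapes `s₁/(M·L^{j(y)})`, `s₂/(M·L^{2j(y)})` of `hcf`, `hc₀`) -/

/-- near the support of `h_□` the blocks have level `≤ j(□) + 1`: if `h_□(x′) ≠ 0` and `|x − x′|_∞ ≤ 1` then `j(y(x)) ≤ j + 1` (file 1's window on the
`3S/2`-collar). [cite: Balaban1984PropagatorsII, (2.2) p.224, p.235, bookkeeping] -/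
theorem lev_le_of_near_supp (hℓ : 1 ≤ ℓ) (i : KIdx d ℓ) {c : ↥(cubes i.D)} {x x' : ↥(i.XB)} (h : hF i.D c x' ≠ 0)
    (hxx' : dist (toR x.1) (toR x'.1) ≤ 1) : (blkOf i.D x).1.1 ≤ c.1.1 + 1 := by
  have hS2 := B6Partition118KLevelFineSizes.two_le_side i.D hℓ i.hMh c
  have hx' := B6Partition118KLevelFine.dist_lt_of_hF_ne_zero i.D i.hMh h
  have hx : dist (toR x.1) (B6Cover236MultiLevelBlocks.ctr i.D c) < 3 / 2 * side i.D c := by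
    have := dist_triangle (toR x.1) (toR x'.1) (B6Cover236MultiLevelBlocks.ctr i.D c); linarith
  exact (B6Partition118KLevelFine.lev_window_of_dist_lt_three_halves i.D i.hMh i.hR hx).2

/-- **THE FIRST-STEP SIZE IN LEVEL FORM**: `C1F/(8S_□/5) ≤ ((5/8)·C1F·L)/(M·L^{j(y)})` whenever `j(y) ≤ j(□) + 1` (`M = L·M_h`, `S_□ = M_h·L^{j+1}`) — the
shape `s₁/(M·L^jη)` of the binder `hcf` up to the factor `η^{−1}` of the lattice derivative, `s₁ := (5/8)·C1F·L`.
[cite: Balaban1984PropagatorsII, (2.92) p.239 line 1, p.247 («O(1)M^{−1}»), bookkeeping] -/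
theorem C1F_div_sF_le_level (i : KIdx d ℓ) (c : ↥(cubes i.D)) {j : ℕ} (hj : j ≤ c.1.1 + 1) :
    C1F d ℓ / sF i.D c ≤ 5 / 8 * C1F d ℓ * ((ℓ : ℝ) + 1) / ((geoB i).M * ((ℓ : ℝ) + 1) ^ j) := by
  have hC := B6Partition118KLevelFineSizes.C1F_nonneg d ℓ
  have hMh : (1 : ℝ) ≤ i.Mh := by exact_mod_cast i.hMh
  have hL : (1 : ℝ) ≤ (ℓ : ℝ) + 1 := by
    have h0 : (0 : ℝ) ≤ ℓ := by positivity
    linarith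
  have hpow : ((ℓ : ℝ) + 1) ^ j ≤ ((ℓ : ℝ) + 1) ^ (c.1.1 + 1) := pow_le_pow_right₀ hL hj
  have hpos : (0 : ℝ) < ((ℓ : ℝ) + 1) ^ j := by positivity
  have eS : sF i.D c = 8 / 5 * (((ℓ : ℝ) + 1) ^ (c.1.1 + 1) * i.Mh) := by
    unfold sF; rw [B6Cover236MultiLevelBlocks.side_eq]; push_cast; ring
  rw [eS, geoB_M, div_le_div_iff₀ (by positivity) (by positivity)]
  -- `C1F·(L·M_h·L^j) ≤ (5/8)C1F·L·(8/5)(L^{j+1}M_h)` ⟸ `L^j ≤ L^{j+1}`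
  have e : 5 / 8 * C1F d ℓ * ((ℓ : ℝ) + 1) * (8 / 5 * (((ℓ : ℝ) + 1) ^ (c.1.1 + 1) * i.Mh)) =
      C1F d ℓ * (((ℓ : ℝ) + 1) * i.Mh * ((ℓ : ℝ) + 1) ^ (c.1.1 + 1)) := by ring
  rw [e]
  exact mul_le_mul_of_nonneg_left (mul_le_mul_of_nonneg_left hpow (by positivity)) hC

/-- **THE SECOND-STEP SIZE IN LEVEL FORM**: `C2F/(8S_□/5)² ≤ ((25/64)·C2F·L)/(M·L^{2j(y)})` whenever `j(y) ≤ j(□) + 1` — the shape `s₂/(M·(L^jη)²)` of the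
binder `hc₀` up to the factor `η^{−2}` of the lattice Laplacian, `s₂ := (25/64)·C2F·L` (one factor `1/M_h ≤ 1` given away).
[cite: Balaban1984PropagatorsII, (2.92) p.239 line 1, p.247 («O(1)M^{−1}»), bookkeeping] -/
theorem C2F_div_sF_sq_le_level (i : KIdx d ℓ) (c : ↥(cubes i.D)) {j : ℕ} (hj : j ≤ c.1.1 + 1) :
    C2F d ℓ / sF i.D c ^ 2 ≤ 25 / 64 * C2F d ℓ * ((ℓ : ℝ) + 1) / ((geoB i).M * ((ℓ : ℝ) + 1) ^ (2 * j)) := by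
  have hC := B6Partition118KLevelFineSecond.C2F_nonneg d ℓ
  have hMh : (1 : ℝ) ≤ i.Mh := by exact_mod_cast i.hMh
  have hL : (1 : ℝ) ≤ (ℓ : ℝ) + 1 := by
    have h0 : (0 : ℝ) ≤ ℓ := by positivity
    linarith
  have hpow : ((ℓ : ℝ) + 1) ^ (2 * j) ≤ ((ℓ : ℝ) + 1) ^ (2 * (c.1.1 + 1)) := pow_le_pow_right₀ hL (by omega)
  have hpos : (0 : ℝ) < ((ℓ : ℝ) + 1) ^ (2 * j) := by positivity
  have eS : sF i.D c = 8 / 5 * (((ℓ : ℝ) + 1) ^ (c.1.1 + 1) * i.Mh) := by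
    unfold sF; rw [B6Cover236MultiLevelBlocks.side_eq]; push_cast; ring
  rw [eS, geoB_M, div_le_div_iff₀ (by positivity) (by positivity)]
  have e : 25 / 64 * C2F d ℓ * ((ℓ : ℝ) + 1) * (8 / 5 * (((ℓ : ℝ) + 1) ^ (c.1.1 + 1) * i.Mh)) ^ 2 =
      C2F d ℓ * (((ℓ : ℝ) + 1) * i.Mh * ((ℓ : ℝ) + 1) ^ (2 * (c.1.1 + 1))) * i.Mh := by ring
  rw [e]
  calc C2F d ℓ * (((ℓ : ℝ) + 1) * i.Mh * ((ℓ : ℝ) + 1) ^ (2 * j))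
      ≤ C2F d ℓ * (((ℓ : ℝ) + 1) * i.Mh * ((ℓ : ℝ) + 1) ^ (2 * (c.1.1 + 1))) :=
        mul_le_mul_of_nonneg_left (mul_le_mul_of_nonneg_left hpow (by positivity)) hC
    _ = C2F d ℓ * (((ℓ : ℝ) + 1) * i.Mh * ((ℓ : ℝ) + 1) ^ (2 * (c.1.1 + 1))) * 1 := (mul_one _).symm
    _ ≤ C2F d ℓ * (((ℓ : ℝ) + 1) * i.Mh * ((ℓ : ℝ) + 1) ^ (2 * (c.1.1 + 1))) * i.Mh :=
        mul_le_mul_of_nonneg_left hMh (by positivity)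

end Literature.MathematicalPhysics.QuantumFieldTheory.Balaban1983to89.B6Partition118KLevelFineKIdx
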